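import Summits.BirchSwinnertonDyer.BirchSwinnertonDyer.Theorems.SignedLowerHalvesKobayashiMainConjectureSmallImageMuTransferCM
import Summits.BirchSwinnertonDyer.BirchSwinnertonDyer.Theorems.SignedLowerHalvesKobayashiMainConjectureSmallImageCMTransferRecordsE
import Summits.BirchSwinnertonDyer.Rank1Residual.Supersingular.SqueezeCertificates
import HarnessLib

/-!
# Route `SignedLowerHalves`, crux `KobayashiMainConjectureSmallImage` (item stmt-BirchSwinnertonDyer-19002):
# the `μ`-SATURATION, part 3 — RANK ONE: the b2b λ-squeeze with `Surj ↦ μ(X^ε) = 0`, and the first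
# rank-one CM-partnered pair (`50112bq1 @ 5`, sign `−`) WITHOUT the preprint
# (cell `bsd-ssimc`, seat `bsd-ssimc-k3-c4` gen 4; helper file, `--supports … --as helper`)

HONEST FRAMING: Kobayashi's signed main conjecture at a non-surjective image is OPEN; nothing here
proves it for the class. CONDITIONAL theorems; the non-published inputs are DISPLAYED binders
(`μ(X^ε) = 0` for the dual data — or the CM-partner data that supply it —, `r_an = 1`, and ONE
two-engine certificate `μ(L_p^ε) = 0, λ(L_p^ε) = 1`, given as a Mazur–Tate element `Θ` with
`ι Θ = θ_n(f₀)`, `μ(Θ) = 0`, `λ(Θ) = deg ω_n^± + 1`); everything else is PUBLISHED and consumed BY NAME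
(B. D. Kim 2009 Cor. 2.13, Pollack–Rubin 2004, Kobayashi 2003 Thm. 1.2 / Thm. 4.1 RATIONAL clause,
Pollack 2003, modularity, GZK, the period-unit facts). NO preprint binder. Item 4 stays OPEN;
nothing booked; BSD is not proved by any of this.

PARTITION (cell bsd-ssimc): X7 (A7) × item 4's 3 rank-1 CM-EC-partnered pairs (50112bq1 @ 5; 228800bl1,
413600l1 @ 3) — types-the-object-of; closes NONE. Only 50112bq1 @ 5 carries a TWO-ENGINE TIGHT
Mazur–Tate row in the tree (`MazurTateRecordsBWX7RankOneC.lean`: n = 1 odd, μ_B = 0, λ_L = λ_T = 1,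
jobs j094264 / j098044); the two pairs at 3 have none and stay modulo the lower half.

## What this file does

The b2b rank-one squeeze `Supersingular.kobayashiMainConjecture_of_lam_eq_one_of_analyticRank_eq_one`
(`KobayashiSqueezeReal.lean`; certificate forms `SqueezeCertificates.lean`): `ξ ∣ L^ε` (Thm. 4.1,
INTEGRAL under surjectivity), `T ∣ ξ` ((C) + GZK, image-free), `μ(L^ε) = 0`, `λ(L^ε) = 1` ⟹
`(ξ) = (L^ε)`. As in parts 1–2, surjectivity enters ONLY through the integrality of `ξ ∣ L^ε`, which
part 1's `signedUpper_dvd_of_hasUnitContent` delivers from `μ(X^ε) = 0` instead. Hence: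

* `kobayashiMainConjecture_of_mu_eq_zero_of_cert_of_analyticRank_eq_one` — IMAGE-FREE rank-one
  squeeze: odd good `p`, `a_p = 0`, `μ(X^ε) = 0` (every datum), `r_an = 1`, certificate
  `μ(L^ε) = 0 ∧ λ(L^ε) = 1` for the newform `f₀` of level `N_E` ⟹ `KobayashiMainConjecture W p ε`;
* `kobayashiMainConjecture_of_cmPartner_of_cert_of_analyticRank_eq_one` — with the CM partner (part 2
  `mu_eq_zero_of_cmPartner`) supplying `μ(X^ε) = 0`: PUBLISHED facts + partner data + the certificate;
* `kobayashiMainConjecture_neg_one_of_cmPartner_of_mazurTate_…` / `…_one_…` — the certificate as ONE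
  odd-level / even-level Mazur–Tate element (`lam_signed_neg_one/one_eq_of_mazurTate'`);
* `kobayashiMainConjecture_c50112bq1_5_neg_one_of_lvalue_of_mazurTate` — the record: `50112bq1 @ 5`
  (Cremona `[0,0,0,−12540,321104]`, `N = 2⁶·3³·29`, `r_an = 1`, image `5Nn`), CM partner
  `y² = x³ − 32` (unit case, `L(E',1)/Ω(E') = 1`), congruence by Fisher's indirect pencil at `(24:1)`
  (as in the landed record `kobayashiMainConjecture_c50112bq1_5_of_transfer_OPEN`, RecordsE), and the
  displayed odd-level Mazur–Tate certificate `Θ` (`n = 1`, `μ = 0`, `λ = deg ω₁⁺ + 1`): Kobayashi's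
  main conjecture for the sign `ε = −1`, NO preprint.

What is NOT here: the sign `+` at 50112bq1 (no even-level tight row recorded); the pairs at 3; the
rank-one `p`-part of BSD (BKO Cor. A.5 consumes the equality — available now for `ε = −1` at this pair
through the route's published inputs, not restated here); anything booked.

References: [BDKim2009] Cor. 2.13; [Kobayashi2003] Thm. 1.2, Thm. 4.1, Conjecture (p. 2);
[Pollack2003] Prop. 6.9, 6.10, 6.18; [PollackRubin2004] Thm. (p. 448); [GreenbergVatsal2000] p. 4,
§3 Rem. 3.4; [Fisher2012Hessian] Thm. 13.2 / [Fisher2013] Thm. 5.8; [Cremona2006].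
-/

set_option autoImplicit false
set_option linter.dupNamespace false

noncomputable section

open scoped Classical MatrixGroups ModularForm

open CongruenceSubgroup WeierstrassCurve Literature.NumberTheory.EllipticCurves
  Literature.NumberTheory.EllipticCurves.ModularForms
  Literature.NumberTheory.EllipticCurves.Kobayashi2003 ZpExtension
  Literature.NumberTheory.EllipticCurves.GreenbergVatsal2000
  Literature.NumberTheory.EllipticCurves.BDKim2009
  Literature.NumberTheory.EllipticCurves.Rank1Residual
  Literature.NumberTheory.EllipticCurves.Rank1Residual.Typed
  Literature.NumberTheory.EllipticCurves.Rank1Residual.X11RankOneCertificates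
  Literature.NumberTheory.EllipticCurves.Fisher2012
  Summit.BirchSwinnertonDyer.BirchSwinnertonDyer.Rank1Residual.IntModel
  Summit.BirchSwinnertonDyer.BirchSwinnertonDyer.Rank1Residual.X11RankOne
  Summit.BirchSwinnertonDyer.Rank1Residual.X11b
  Summit.BirchSwinnertonDyer.Rank1Residual.X9
  Summit.BirchSwinnertonDyer.Rank1Residual.X1
  Summit.BirchSwinnertonDyer.Rank1Residual.X1.MuLambda
  Summit.BirchSwinnertonDyer.Rank1Residual.Supersingular

namespace Summit.BirchSwinnertonDyer.BirchSwinnertonDyer.Theorems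

section RankOne

variable (W W' : WeierstrassCurve ℚ) [W.IsElliptic] [W.IsGloballyMinimal] [W'.IsElliptic]
  [W'.IsGloballyMinimal] (p : ℕ) [Fact p.Prime]

/-- **IMAGE-FREE rank-one squeeze: `μ(X^ε) = 0` + the certificate `(μ, λ)(L_p^ε) = (0, 1)` ⇒ Kobayashi's
main conjecture for `(E, p, ε)`.** `p` odd good, `a_p = 0`, `ord_{s=1} L(E,s) = 1`, every dual datum of
`Sel^ε(E/ℚ_∞)` with `μ = 0` (`hμ`), and for the newform `f₀` of level `N_E` the certificate `hcert₀`
(`μ(L) = 0 ∧ λ(L) = 1` for every `L` that is Pollack's `L_p^ε` — ONE power series). Granted BY NAME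
Kobayashi Thm. 1.2 (`h12`), Thm. 4.1 RATIONAL (`h41`), the period-unit facts (`h5`, `h3`), GZK (`hGZK`):
`KobayashiMainConjecture W p ε`. Proof = b2b's `kobayashiMainConjecture_of_cert_at_conductor_of_analyticRank_eq_one`
VERBATIM with the integral `ξ ∣ L^ε` taken from `signedUpper_dvd_of_hasUnitContent` (part 1) instead of
surjectivity; `T ∣ ξ` is (C) + GZK (image-free). CONDITIONAL on the displayed binders; per pair.
[cite: Kobayashi2003, Thm. 1.2 (p. 2), Thm. 4.1 (p. 8) and Conjecture (p. 2)]
[cite: GreenbergVatsal2000, p. 4 and §3 Remark 3.4] -/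
theorem kobayashiMainConjecture_of_mu_eq_zero_of_cert_of_analyticRank_eq_one
    (h12 : Kobayashi2003.thm12_signedSelmerDual_finite_torsion)
    (h41 : Kobayashi2003.thm41_signedCharIdeal_divisibility)
    (h5 : realPeriodRat_eq_unit_mul_plusPeriod) (h3 : realPeriodRat_eq_unit_mul_plusPeriod_three)
    (hGZK : rank_eq_analyticRank_of_analyticRank_le_one)
    (hp : p ≠ 2) (hgood : W.HasGoodReductionAtPrime p) (hap : W.frobeniusTrace p = 0) {ε : ℤˣ}
    (hμ : ∀ (κ : ZpExtension ℚ p) (γ : Field.absoluteGaloisGroup ℚ),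
      κ.IsCyclotomic → κ.IsTopGenerator γ → IsCyclotomicVariable p γ →
      ∀ (D : SignedSelmerDualData W κ γ ε), D.mu = 0)
    (h1 : W.analyticRank = 1)
    [NeZero (W.conductorNorm ℤ)] {f₀ : CuspForm (Gamma0 (W.conductorNorm ℤ)) 2} (hf₀ : IsNewformOf W f₀)
    (hcert₀ : ∀ L : IwasawaAlgebra p, IsSignedPAdicLFunction f₀ p ε L → mu L = 0 ∧ lam L = 1) :
    KobayashiMainConjecture W p ε := by
  intro κ γ hκ hγ hγ' _ f hf ϖ hϖ Lplus Lminus hPP D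
  have hff : f = f₀ := hf.unique hf₀
  subst hff
  haveI : Module.Finite (IwasawaAlgebra p) D.X := h12.moduleFinite hp hgood hap hκ hγ D
  have hX : Module.IsTorsion (IwasawaAlgebra p) D.X := h12.isTorsion hp hgood hap hκ hγ D
  refine ⟨hX, ?_⟩
  obtain ⟨ξ, hξ⟩ := (charIdeal_isPrincipal_holds p D.X).principal
  have hξ' : D.charIdeal = Ideal.span {ξ} := hξ
  have huξ : HasUnitContent ξ :=
    (muInvariant_eq_zero_iff_hasUnitContent D.X hX hξ').mp (hμ κ γ hκ hγ hγ' D)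
  set L := kobayashiL ε Lplus Lminus with hL_def
  have hL : IsSignedPAdicLFunction f p ε L := hPP.isSignedPAdicLFunction_kobayashiL ε
  -- (MC↑), INTEGRAL from `μ(X^ε) = 0` (part 1), no image hypothesis
  have hU : ξ ∣ L := signedUpper_dvd_of_hasUnitContent h41 hp hgood hap hf hκ hγ hγ' hL D hX hξ' huξ
  -- (C): `T^{rank E(ℚ)} ∣ ξ`, `rank E(ℚ) = 1` by GZK
  have hC := D.X_pow_mordellWeilRank_dvd_of_charIdeal_eq_span hγ hX hξ'
  have hrank : W.mordellWeilRank = 1 := (hGZK W (by omega)).1.trans h1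
  rw [hrank, pow_one] at hC
  obtain ⟨hμL, hlam⟩ := hcert₀ L hL
  have hspan : Ideal.span ({ξ} : Set (IwasawaAlgebra p)) = Ideal.span {L} :=
    span_eq_span_of_dvd_of_X_dvd_of_lam_eq_one hU hC hμL hlam
  have hirr : W.HasIrreducibleModPGaloisRep p :=
    hasIrreducibleModPGaloisRep_of_dvd_frobeniusTrace W p hp
      (W.not_dvd_minimalDiscriminantInt_of_hasGoodReductionAtPrime' p hgood) (by rw [hap]; exact dvd_zero _)
  have hvϖ : padicValRat p ϖ = 0 := padicValRat_periodRatio_eq_zero h5 h3 W p hp hgood hirr f hf ϖ hϖ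
  have hϖ0 : ϖ ≠ 0 := by
    intro h0
    rw [h0, Rat.cast_zero, zero_mul] at hϖ
    exact (IsNewform0.plusPeriod_pos_holds hf.1 hf.coeffField_eq_bot).ne' hϖ.symm
  obtain ⟨u, hu⟩ := exists_units_coe_eq_ratCast hϖ0 hvϖ
  obtain ⟨hspan', hι⟩ := span_C_units_mul_eq u L
  refine ⟨PowerSeries.C (u : ℤ_[p]) * L, ?_, ?_⟩
  · rw [hξ', hspan, hspan']
  · rw [hι, hu]

/-- **Rank one, CM-partnered: the certificate `(μ, λ)(L_p^ε) = (0, 1)` ⇒ Kobayashi's main conjecture for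
`(E, p, ε)` — PUBLISHED facts + partner data, NO image hypothesis, NO preprint.** The partner (as in
`mu_eq_zero_of_cmPartner`: `hcm'`, `hss'`, `hap'`, `hiso`, `hμ'`) supplies `μ(X^ε(E)) = 0` by B. D. Kim
2009 (`h09`) + Pollack–Rubin (`hPR`); then `kobayashiMainConjecture_of_mu_eq_zero_of_cert_of_analyticRank_eq_one`.
CONDITIONAL on the displayed binders; per pair. [cite: BDKim2009, Cor. 2.13 (p. 187)]
[cite: PollackRubin2004, Theorem (p. 448) = Thm. 7.3] [cite: Kobayashi2003, Thm. 4.1 (p. 8) and Conjecture (p. 2)] -/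
theorem kobayashiMainConjecture_of_cmPartner_of_cert_of_analyticRank_eq_one
    (h09 : cor213_signedMu_eq_zero_iff_of_torsionIso)
    (hPR : PollackRubin2004.mainTheorem_signedCharIdeal_eq_of_cm)
    (h12 : Kobayashi2003.thm12_signedSelmerDual_finite_torsion)
    (h41 : Kobayashi2003.thm41_signedCharIdeal_divisibility)
    (h5 : realPeriodRat_eq_unit_mul_plusPeriod) (h3 : realPeriodRat_eq_unit_mul_plusPeriod_three)
    (hPollack : ∀ {V : WeierstrassCurve ℚ} [V.IsElliptic] [V.IsGloballyMinimal] {N : ℕ} [NeZero N]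
      {g : CuspForm (Gamma0 N) 2} {q : ℕ} [Fact q.Prime],
      pollack_exists_plusMinusPAdicLFunction (W := V) (f := g) (p := q))
    (hmod : nonempty_modularParametrizationData)
    (hGZK : rank_eq_analyticRank_of_analyticRank_le_one)
    (hp : p ≠ 2) (hgood : W.HasGoodReductionAtPrime p) (hap : W.frobeniusTrace p = 0)
    (hcm' : W'.HasCM) (hss' : GoodSS W' p) (hap' : W'.frobeniusTrace p = 0)
    (hiso : ∃ e : geomTorsion W (p : ℤ) ≃+ geomTorsion W' (p : ℤ),
      ∀ (σ : Field.absoluteGaloisGroup ℚ) (P : geomTorsion W (p : ℤ)), e (σ • P) = σ • e P)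
    (hμ' : ∀ [NeZero (W'.conductorNorm ℤ)] (f' : CuspForm (Gamma0 (W'.conductorNorm ℤ)) 2),
      IsNewformOf W' f' → ∀ (Lplus Lminus : IwasawaAlgebra p), IsPollackPair f' p Lplus Lminus →
      ∀ ε : ℤˣ, HasUnitContent (kobayashiL ε Lplus Lminus))
    (h1 : W.analyticRank = 1) (ε : ℤˣ)
    [NeZero (W.conductorNorm ℤ)] {f₀ : CuspForm (Gamma0 (W.conductorNorm ℤ)) 2} (hf₀ : IsNewformOf W f₀)
    (hcert₀ : ∀ L : IwasawaAlgebra p, IsSignedPAdicLFunction f₀ p ε L → mu L = 0 ∧ lam L = 1) :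
    KobayashiMainConjecture W p ε :=
  kobayashiMainConjecture_of_mu_eq_zero_of_cert_of_analyticRank_eq_one W p h12 h41 h5 h3 hGZK hp hgood hap
    (fun _κ _γ hκ hγ hγ' D ↦ mu_eq_zero_of_cmPartner W W' p h09 hPR h12 h5 h3 hPollack hmod hp hgood hap
      hcm' hss' hap' hiso hμ' hκ hγ hγ' ε D)
    h1 hf₀ hcert₀

/-- **Rank one, CM-partnered, sign `−` (the tree's `L⁺`, odd levels): ONE odd-level Mazur–Tate
certificate ⇒ Kobayashi's main conjecture for `(E, p, −1)`** — the certificate as a non-zero `Θ ∈ Λ`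
with `ι Θ = θ_n(f₀)`, `n` odd, `μ(Θ) = 0`, `λ(Θ) = deg ω_n^+ + 1` (`lam_signed_neg_one_eq_of_mazurTate'`).
PUBLISHED facts + partner data + the displayed `Θ`; NO preprint. Per pair.
[cite: Pollack2003, Prop. 6.9, Prop. 6.10 and Prop. 6.18] [cite: BDKim2009, Cor. 2.13 (p. 187)]
[cite: Kobayashi2003, Thm. 4.1 (p. 8) and Conjecture (p. 2)] -/
theorem kobayashiMainConjecture_neg_one_of_cmPartner_of_mazurTate_of_analyticRank_eq_one
    (h09 : cor213_signedMu_eq_zero_iff_of_torsionIso)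
    (hPR : PollackRubin2004.mainTheorem_signedCharIdeal_eq_of_cm)
    (h12 : Kobayashi2003.thm12_signedSelmerDual_finite_torsion)
    (h41 : Kobayashi2003.thm41_signedCharIdeal_divisibility)
    (h5 : realPeriodRat_eq_unit_mul_plusPeriod) (h3 : realPeriodRat_eq_unit_mul_plusPeriod_three)
    (hPollack : ∀ {V : WeierstrassCurve ℚ} [V.IsElliptic] [V.IsGloballyMinimal] {N : ℕ} [NeZero N]
      {g : CuspForm (Gamma0 N) 2} {q : ℕ} [Fact q.Prime],
      pollack_exists_plusMinusPAdicLFunction (W := V) (f := g) (p := q))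
    (hmod : nonempty_modularParametrizationData)
    (hGZK : rank_eq_analyticRank_of_analyticRank_le_one)
    (hp : p ≠ 2) (hgood : W.HasGoodReductionAtPrime p) (hap : W.frobeniusTrace p = 0)
    (hcm' : W'.HasCM) (hss' : GoodSS W' p) (hap' : W'.frobeniusTrace p = 0)
    (hiso : ∃ e : geomTorsion W (p : ℤ) ≃+ geomTorsion W' (p : ℤ),
      ∀ (σ : Field.absoluteGaloisGroup ℚ) (P : geomTorsion W (p : ℤ)), e (σ • P) = σ • e P)
    (hμ' : ∀ [NeZero (W'.conductorNorm ℤ)] (f' : CuspForm (Gamma0 (W'.conductorNorm ℤ)) 2),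
      IsNewformOf W' f' → ∀ (Lplus Lminus : IwasawaAlgebra p), IsPollackPair f' p Lplus Lminus →
      ∀ ε : ℤˣ, HasUnitContent (kobayashiL ε Lplus Lminus))
    (h1 : W.analyticRank = 1)
    [NeZero (W.conductorNorm ℤ)] {f₀ : CuspForm (Gamma0 (W.conductorNorm ℤ)) 2} (hf₀ : IsNewformOf W f₀)
    {n : ℕ} (hn : Odd n) {Θ : IwasawaAlgebra p}
    (hΘ : iwasawaToPowerSeries p Θ =
      ((mazurTateElement f₀ p n).map (algebraMap ℚ ℚ_[p]) : PowerSeries ℚ_[p]))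
    (hΘ0 : Θ ≠ 0) (hμΘ : mu Θ = 0) (hlam : lam Θ = (cyclotomicOmegaPlus p n).natDegree + 1) :
    KobayashiMainConjecture W p (-1) :=
  kobayashiMainConjecture_of_cmPartner_of_cert_of_analyticRank_eq_one W W' p h09 hPR h12 h41 h5 h3
    hPollack hmod hGZK hp hgood hap hcm' hss' hap' hiso hμ' h1 (-1) hf₀ fun _ hL ↦
      lam_signed_neg_one_eq_of_mazurTate' hp hf₀ hgood hap hL hn hΘ hΘ0 hμΘ hlam

/-- **Rank one, CM-partnered, sign `+` (the tree's `L⁻`, even levels): ONE even-level Mazur–Tate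
certificate ⇒ Kobayashi's main conjecture for `(E, p, 1)`** (`λ(Θ) = deg ω_n^- + 1`, `n` even;
`lam_signed_one_eq_of_mazurTate'`). PUBLISHED facts + partner data + the displayed `Θ`; NO preprint.
[cite: Pollack2003, Prop. 6.9, Prop. 6.10 and Prop. 6.18] [cite: BDKim2009, Cor. 2.13 (p. 187)]
[cite: Kobayashi2003, Thm. 4.1 (p. 8) and Conjecture (p. 2)] -/
theorem kobayashiMainConjecture_one_of_cmPartner_of_mazurTate_of_analyticRank_eq_one
    (h09 : cor213_signedMu_eq_zero_iff_of_torsionIso)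
    (hPR : PollackRubin2004.mainTheorem_signedCharIdeal_eq_of_cm)
    (h12 : Kobayashi2003.thm12_signedSelmerDual_finite_torsion)
    (h41 : Kobayashi2003.thm41_signedCharIdeal_divisibility)
    (h5 : realPeriodRat_eq_unit_mul_plusPeriod) (h3 : realPeriodRat_eq_unit_mul_plusPeriod_three)
    (hPollack : ∀ {V : WeierstrassCurve ℚ} [V.IsElliptic] [V.IsGloballyMinimal] {N : ℕ} [NeZero N]
      {g : CuspForm (Gamma0 N) 2} {q : ℕ} [Fact q.Prime],
      pollack_exists_plusMinusPAdicLFunction (W := V) (f := g) (p := q))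
    (hmod : nonempty_modularParametrizationData)
    (hGZK : rank_eq_analyticRank_of_analyticRank_le_one)
    (hp : p ≠ 2) (hgood : W.HasGoodReductionAtPrime p) (hap : W.frobeniusTrace p = 0)
    (hcm' : W'.HasCM) (hss' : GoodSS W' p) (hap' : W'.frobeniusTrace p = 0)
    (hiso : ∃ e : geomTorsion W (p : ℤ) ≃+ geomTorsion W' (p : ℤ),
      ∀ (σ : Field.absoluteGaloisGroup ℚ) (P : geomTorsion W (p : ℤ)), e (σ • P) = σ • e P)
    (hμ' : ∀ [NeZero (W'.conductorNorm ℤ)] (f' : CuspForm (Gamma0 (W'.conductorNorm ℤ)) 2),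
      IsNewformOf W' f' → ∀ (Lplus Lminus : IwasawaAlgebra p), IsPollackPair f' p Lplus Lminus →
      ∀ ε : ℤˣ, HasUnitContent (kobayashiL ε Lplus Lminus))
    (h1 : W.analyticRank = 1)
    [NeZero (W.conductorNorm ℤ)] {f₀ : CuspForm (Gamma0 (W.conductorNorm ℤ)) 2} (hf₀ : IsNewformOf W f₀)
    {n : ℕ} (hn : Even n) {Θ : IwasawaAlgebra p}
    (hΘ : iwasawaToPowerSeries p Θ =
      ((mazurTateElement f₀ p n).map (algebraMap ℚ ℚ_[p]) : PowerSeries ℚ_[p]))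
    (hΘ0 : Θ ≠ 0) (hμΘ : mu Θ = 0) (hlam : lam Θ = (cyclotomicOmegaMinus p n).natDegree + 1) :
    KobayashiMainConjecture W p 1 :=
  kobayashiMainConjecture_of_cmPartner_of_cert_of_analyticRank_eq_one W W' p h09 hPR h12 h41 h5 h3
    hPollack hmod hGZK hp hgood hap hcm' hss' hap' hiso hμ' h1 1 hf₀ fun _ hL ↦
      lam_signed_one_eq_of_mazurTate' hp hf₀ hgood hap hL hn hΘ hΘ0 hμΘ hlam

end RankOne

/-- **Kobayashi's main conjecture for `(50112bq1, 5, −1)`** (Cremona model `[0, 0, 0, −12540, 321104]`,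
`N = 50112 = 2⁶·3³·29`, analytic rank `1`, image `5Nn` — item 4's rank-one pair at `p = 5`) **from
PUBLISHED named facts + displayed certificates, NO preprint.** Same CM partner `A : y² = x³ − 32`
(unit case: `L(A,1)/Ω(A) = 1`, a `5`-adic unit ⟹ `μ(L_p^±(A)) = 0` a THEOREM, Kurihara) and same
kernel-certified congruence `E[5] ≃ A[5]` (Fisher's indirect pencil `X⁵` at `(24 : 1)`,
`u = 5283615080448`, `fiveCongruent_of_hesseIndCertificate` with the named fact `hF'` = Fisher 2013
Thm. 5.8, identities by `norm_num`) as the landed L4-CM record `kobayashiMainConjecture_c50112bq1_5_of_transfer_OPEN`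
(RecordsE), whose OPEN binder `hCL` is REPLACED by {`h09` Kim 2009, `h12`/`h41` Kobayashi, `hPollack`,
`hmod`, `hGZK`} PUBLISHED + Cremona's `r_an = 1` (`h1`) + the displayed ODD-LEVEL Mazur–Tate certificate:
the newform `f₀` of level `N_E` (`hf₀`) and `Θ ∈ Λ` with `ι Θ = θ₁(f₀)`, `Θ ≠ 0`, `μ(Θ) = 0`,
`λ(Θ) = deg ω₁⁺ + 1` (the tree's TWO-ENGINE TIGHT row for this pair: `MazurTateRecordsBWX7RankOneC.lean`,
label 50112bq1, p = 5, layer n = 1 odd, μ_B = 0, λ_{θ,B} = λ_L = 1, torsion-module engine v_T = 1,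
μ_T = 0, λ_T = 1; kit jobs j094264 / j098044 — quoted, not re-run). Kernel-decided: `5 ∤ Δ` (both),
`#Ẽ(𝔽_5) = #Ã(𝔽_5) = 6` (`a_5 = 0`), CM of `A`. Per pair; sign `+` not claimed (no even-level tight row);
item 4 stays OPEN; nothing booked; BSD is not proved by any of this.
[cite: BDKim2009, Cor. 2.13 (p. 187)] [cite: Pollack2003, Prop. 6.9, Prop. 6.10 and Prop. 6.18]
[cite: Fisher2012Hessian, Thm. 13.2] [cite: Cremona2006, Table 1 (Cremona label 50112bq1)] -/
theorem kobayashiMainConjecture_c50112bq1_5_neg_one_of_lvalue_of_mazurTate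
    (h09 : cor213_signedMu_eq_zero_iff_of_torsionIso)
    (hPR : PollackRubin2004.mainTheorem_signedCharIdeal_eq_of_cm)
    (h12 : Kobayashi2003.thm12_signedSelmerDual_finite_torsion)
    (h41 : Kobayashi2003.thm41_signedCharIdeal_divisibility)
    (h5 : realPeriodRat_eq_unit_mul_plusPeriod) (h3 : realPeriodRat_eq_unit_mul_plusPeriod_three)
    (hPollack : ∀ {V : WeierstrassCurve ℚ} [V.IsElliptic] [V.IsGloballyMinimal] {N : ℕ} [NeZero N]
      {g : CuspForm (Gamma0 N) 2} {q : ℕ} [Fact q.Prime],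
      pollack_exists_plusMinusPAdicLFunction (W := V) (f := g) (p := q))
    (hmod : nonempty_modularParametrizationData)
    (hGZK : rank_eq_analyticRank_of_analyticRank_le_one)
    (hF' : thm58_fiveCongruent_hessePencilInd)
    (W A : WeierstrassCurve ℚ) [W.IsElliptic] [W.IsGloballyMinimal] [A.IsElliptic] [A.IsGloballyMinimal]
    [Fact (Nat.Prime 5)] (hW : W = ⟨0, 0, 0, -12540, 321104⟩) (hA : A = ⟨0, 0, 0, 0, -32⟩)
    (hL' : A.entireLFunction 1 / (A.realPeriodRat : ℂ) = ((1 : ℚ) : ℂ))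
    (h1 : W.analyticRank = 1)
    [NeZero (W.conductorNorm ℤ)] {f₀ : CuspForm (Gamma0 (W.conductorNorm ℤ)) 2} (hf₀ : IsNewformOf W f₀)
    {Θ : IwasawaAlgebra 5}
    (hΘ : iwasawaToPowerSeries 5 Θ =
      ((mazurTateElement f₀ 5 1).map (algebraMap ℚ ℚ_[5]) : PowerSeries ℚ_[5]))
    (hΘ0 : Θ ≠ 0) (hμΘ : mu Θ = 0) (hlam : lam Θ = (cyclotomicOmegaPlus 5 1).natDegree + 1) :
    KobayashiMainConjecture W 5 (-1) := by
  have hIW : integralModelInt W = ⟨0, 0, 0, -12540, 321104⟩ :=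
    integralModelInt_eq_of_map_eq _ (by rw [hW]; ext <;> simp [WeierstrassCurve.map])
  have hIA : integralModelInt A = ⟨0, 0, 0, 0, -32⟩ :=
    integralModelInt_eq_of_map_eq _ (by rw [hA]; ext <;> simp [WeierstrassCurve.map])
  have hΔ : (⟨0, 0, 0, -12540, 321104⟩ : WeierstrassCurve ℤ).Δ = discOf [0, 0, 0, -12540, 321104] :=
    intCurve_Δ 0 0 0 (-12540) 321104
  have hΔA : (⟨0, 0, 0, 0, -32⟩ : WeierstrassCurve ℤ).Δ = discOf [0, 0, 0, 0, -32] :=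
    intCurve_Δ 0 0 0 0 (-32)
  have hgood : W.HasGoodReductionAtPrime 5 :=
    hasGoodReductionAtPrime_of_not_dvd W 5 (by rw [minimalDiscriminantInt_eq hIW, hΔ]; decide +kernel)
  have hgoodA : A.HasGoodReductionAtPrime 5 :=
    hasGoodReductionAtPrime_of_not_dvd A 5 (by rw [minimalDiscriminantInt_eq hIA, hΔA]; decide +kernel)
  have hap : W.frobeniusTrace 5 = 0 := by rw [frobeniusTrace_eq hIW card_c50112bq1_5]; norm_num
  have hapA : A.frobeniusTrace 5 = 0 := by rw [frobeniusTrace_eq hIA card_cm0m32_5]; norm_num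
  have hc4 : W.c₄ = (601920 : ℚ) := by
    subst hW; norm_num [WeierstrassCurve.c₄, WeierstrassCurve.b₂, WeierstrassCurve.b₄]
  have hc6 : W.c₆ = (-277433856 : ℚ) := by
    subst hW; norm_num [WeierstrassCurve.c₆, WeierstrassCurve.b₂, WeierstrassCurve.b₄, WeierstrassCurve.b₆]
  have hc4A : A.c₄ = (0 : ℚ) := by
    subst hA; norm_num [WeierstrassCurve.c₄, WeierstrassCurve.b₂, WeierstrassCurve.b₄]
  have hc6A : A.c₆ = (27648 : ℚ) := by
    subst hA; norm_num [WeierstrassCurve.c₆, WeierstrassCurve.b₂, WeierstrassCurve.b₄, WeierstrassCurve.b₆]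
  have hiso := fiveCongruent_of_hesseIndCertificate hF' A W (24 : ℚ) 1 (5283615080448 : ℚ)
    (by norm_num) (by rw [hc4A, hc6A, hc4, eval_hesseC4ind]; norm_num)
    (by rw [hc4A, hc6A, hc6, eval_hesseC6ind]; norm_num)
  exact kobayashiMainConjecture_neg_one_of_cmPartner_of_mazurTate_of_analyticRank_eq_one W A 5 h09 hPR h12
    h41 h5 h3 hPollack hmod hGZK (by norm_num) hgood hap (hasCM_cm0m32 hIA)
    ⟨hgoodA, by rw [hapA]; exact dvd_zero _⟩ hapA hiso
    (hasUnitContent_kobayashiL_of_lvalue A 5 h5 h3 (by norm_num) hgoodA hapA (by norm_num) hL'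
      (by rw [show (1 : ℚ) = ((1 : ℕ) : ℚ) / (1 : ℕ) by norm_num]
          exact padicValRat_natCast_div_natCast_eq_zero 5 1 1 (by norm_num) (by norm_num)))
    h1 hf₀ odd_one hΘ hΘ0 hμΘ hlam

end Summit.BirchSwinnertonDyer.BirchSwinnertonDyer.Theorems

end
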